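import Mathlib.RingTheory.SimpleModule.Basic
import Mathlib.LinearAlgebra.Projection
import Mathlib.Algebra.Algebra.Subalgebra.Operations
import Mathlib.Algebra.Algebra.Rat
import Mathlib.RingTheory.TensorProduct.Maps
import Mathlib.Data.Set.Card
import HarnessLib

/-!
# Semisimplicity descends along bimodule retractions; fixed rings of finite groups

Let `f : S → R` be a ring homomorphism and `t : R → S` an additive map which is `S`-linear on both
sides (`t (f a · r) = a · t r`, `t (r · f b) = t r · b`) with `t 1 = 1` — a *retraction of
`S`-bimodules* (so `t ∘ f = id` and `f` is injective). If `R` is a semisimple ring then so is `S`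
(`isSemisimpleRing_of_retraction`): for a left ideal `I ⊆ S`, an `R`-linear projection `p` of `R`
onto the left ideal `R · f(I)` exists because `R` is semisimple, and `a ↦ t (p (f a))` is an
`S`-linear projection of `S` onto `I` (`t` maps `R · f(I)` into `S · I = I` by right linearity),
so `I` is a direct summand of `S`.

The classical instance is the **trace of a finite group of automorphisms**: for a finite group
`G` acting on a ring `R` by ring automorphisms with `|G|` invertible in `R`, the map
`t(r) = |G|⁻¹ ∑_{g ∈ G} g · r` is an `R^G`-bimodule retraction `R → R^G` (S. Montgomery, *Hopf
algebras and their actions on rings* (1993), §4.3, Lemma 4.3.2: "the map `t̂ : A → A` given by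
`t̂(a) = t · a` is an `A^H`-bimodule map with values in `A^H`", here for `H = kG`,
`t = ∑ g`), whence **the fixed ring `R^G` of a semisimple (artinian) ring is semisimple when
`|G|⁻¹ ∈ R`** (`isSemisimpleRing_fixedPoints`; M. Cohen and S. Montgomery, *Semi-simple artinian
rings of fixed points*, Canad. Math. Bull. 18 (1975), Theorem: the conclusion holds more generally
when `R` has no additive `|G|`-torsion — only the case `|G|⁻¹ ∈ R`, where the averaging argument
above applies verbatim, is proved here). We also record the variants actually needed for Galois
descent of semisimplicity of endomorphism algebras of abelian varieties
(`Literature.AlgebraicGeometry.Motives.AbelianVarietyEndAlgebraDescent`): an arbitrary group acting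
through **finitely many** ring endomorphisms (`isSemisimpleRing_fixedPoints_of_finite_range`, e.g. a
profinite Galois group acting with open stabilisers on a finitely generated ring), the `ℚ`-algebra
forms in which the invertibility of `|G|` is automatic, and the form in which the retraction is
only given integrally up to a non-zero integer `n` (`t ∘ f = n · id` on rings `S₀ → R₀`) and
semisimplicity descends from `ℚ ⊗ R₀` to `ℚ ⊗ S₀` (`isSemisimpleRing_ratTensor_of_trace`).

Mathlib has semisimple modules and rings (`IsSemisimpleRing`, `IsSemisimpleModule`), projections
onto complemented submodules (`Submodule.projection`, `LinearMap.isCompl_of_proj`), fixed subrings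
(`FixedPoints.subring`) and `RingHom.isSemisimpleRing_of_surjective`, but no statement that
semisimplicity passes to fixed subrings or retracts (searched: `IsSemisimpleRing` with
`FixedPoints`, `retract`, `fixedPoints`; no hits).

## References

* [CohenMontgomery1975] M. Cohen, S. Montgomery, *Semi-simple artinian rings of fixed points*,
  Canad. Math. Bull. 18 (1975), 189–190, Theorem (doi:10.4153/cmb-1975-037-9; not held — the
  special case `|G|⁻¹ ∈ R` proved here is the classical averaging argument).
* [Montgomery1993Hopf] S. Montgomery, *Hopf algebras and their actions on rings*, CBMS 82, AMS
  (1993), §4.3, Lemma 4.3.2 and Definition 4.3.3 (trace functions), §2.2 (Maschke) (held: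
  `book:montgomery1993-hopf-algebras-their-actions-rings`, PDF pp. 21, 41, read).

## Design

Theorems only; `namespace Literature.RingTheory.SimpleModule`. The retraction lemma is stated for
an arbitrary ring homomorphism `f : S →+* R` and an additive `t : R →+ S` (no bimodule structures
are introduced); the fixed-ring statements are for Mathlib's `FixedPoints.subring R G` and
`MulSemiringAction`. Mathlib used: `exists_isCompl`, `Submodule.projection`,
`Submodule.projection_apply_mem`, `Submodule.projection_apply_of_mem_left`,
`LinearMap.isCompl_of_proj`, `Submodule.span_induction`, `MulSemiringAction.toRingHom`,
`Finset.sum_nbij'`, `Function.Bijective.sum_comp`, `Algebra.TensorProduct.map`,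
`TensorProduct.map`, `TensorProduct.induction_on`.
-/

open scoped TensorProduct

namespace Literature.RingTheory.SimpleModule

/-! ### Retractions of bimodules -/

section Retraction

variable {S R : Type*} [Ring S] [Ring R]

/-- **Semisimplicity descends along a retraction of bimodules.** Let `f : S → R` be a ring
homomorphism and `t : R → S` an additive map with `t (f a · r) = a · t r`, `t (r · f b) = t r · b`
and `t 1 = 1`. If `R` is a semisimple ring, so is `S`: for a left ideal `I` of `S` choose an
`R`-linear projection `p` of `R` onto `R · f(I)` (possible since `R` is semisimple); then
`a ↦ t (p (f a))` is an `S`-linear projection of `S` onto `I` — it takes values in `I` because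
`t (∑ rᵢ f(bᵢ)) = ∑ t(rᵢ) bᵢ ∈ I`, and fixes `I` because `t (f a) = a` — so `I` is complemented.
(The averaging argument of Maschke's theorem / of the trace function of a finite group,
Montgomery 1993, Lemma 4.3.2, abstracted.) [folklore] -/
theorem isSemisimpleRing_of_retraction [IsSemisimpleRing R] (f : S →+* R) (t : R →+ S)
    (hl : ∀ (a : S) (r : R), t (f a * r) = a * t r)
    (hr : ∀ (r : R) (b : S), t (r * f b) = t r * b) (h1 : t 1 = 1) :
    IsSemisimpleRing S := by
  have htf : ∀ a : S, t (f a) = a := fun a ↦ by rw [← mul_one (f a), hl, h1, mul_one]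
  refine (isSemisimpleModule_iff S S).mpr ⟨fun I ↦ ?_⟩
  -- the left ideal `J = R · f(I)` of `R` and the `R`-linear projection `p` of `R` onto it
  set J : Submodule R R := Submodule.span R (f '' (I : Set S)) with hJ
  obtain ⟨J', hJJ'⟩ := exists_isCompl J
  -- `t` maps `J` into `I` (right `S`-linearity)
  have htJ : ∀ x ∈ J, t x ∈ I := by
    intro x hx
    suffices h : ∀ r : R, t (r * x) ∈ I by simpa using h 1
    induction hx using Submodule.span_induction with
    | mem x hx =>
      obtain ⟨b, hb, rfl⟩ := hx
      intro r
      rw [hr]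
      exact I.smul_mem (t r) hb
    | zero => intro r; rw [mul_zero, map_zero]; exact I.zero_mem
    | add x y _ _ hx hy => intro r; rw [mul_add, map_add]; exact I.add_mem (hx r) (hy r)
    | smul a x _ hx => intro r; rw [smul_eq_mul, ← mul_assoc]; exact hx (r * a)
  -- the `S`-linear projection `q` of `S` onto `I`
  let q : S →ₗ[S] I :=
    { toFun := fun a ↦ ⟨t (J.projection J' hJJ' (f a)), htJ _ (Submodule.projection_apply_mem hJJ' _)⟩
      map_add' := fun a b ↦ by
        ext
        simp only [map_add, Submodule.coe_add]
      map_smul' := fun s a ↦ by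
        ext
        simp only [smul_eq_mul, map_mul, RingHom.id_apply, Submodule.coe_smul_of_tower]
        rw [← smul_eq_mul (f s), map_smul, smul_eq_mul, hl] }
  have hq : ∀ x : I, q x = x := by
    rintro ⟨a, ha⟩
    ext
    change t (J.projection J' hJJ' (f a)) = a
    rw [Submodule.projection_apply_of_mem_left hJJ' (Submodule.subset_span ⟨a, ha, rfl⟩), htf]
  exact ⟨LinearMap.ker q, LinearMap.isCompl_of_proj hq⟩

/-- **Semisimplicity descends along an averaging family of ring endomorphisms.** Let `S` be a
subring of a semisimple ring `R`, `(σᵢ)_{i ∈ s}` finitely many ring endomorphisms of `R` fixing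
`S` pointwise such that `∑ᵢ σᵢ(r) ∈ S` for every `r`, and `c ∈ S` an element commuting with `S`
with `c · |s| = 1`. Then `S` is semisimple: `t(r) = c ∑ᵢ σᵢ(r)` is an `S`-bimodule retraction
`R → S` (`isSemisimpleRing_of_retraction`). [folklore] -/
theorem isSemisimpleRing_subring_of_sum_mem [IsSemisimpleRing R] (T : Subring R) {ι : Type*}
    (s : Finset ι) (σ : ι → R →+* R) (hσ : ∀ i ∈ s, ∀ a ∈ T, σ i a = a)
    (hsum : ∀ r : R, ∑ i ∈ s, σ i r ∈ T) (c : R) (hc : c ∈ T) (hcomm : ∀ a ∈ T, Commute c a)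
    (hc1 : c * (s.card : R) = 1) : IsSemisimpleRing T := by
  -- the trace `t(r) = c ∑ᵢ σᵢ(r)`, with values in `T`
  let t : R →+ T :=
    { toFun := fun r ↦ ⟨c * ∑ i ∈ s, σ i r, T.mul_mem hc (hsum r)⟩
      map_zero' := by ext; simp
      map_add' := fun x y ↦ by ext; simp [Finset.sum_add_distrib, mul_add] }
  refine isSemisimpleRing_of_retraction T.subtype t (fun a r ↦ ?_) (fun r b ↦ ?_) ?_
  · ext
    change c * ∑ i ∈ s, σ i ((a : R) * r) = (a : R) * (c * ∑ i ∈ s, σ i r)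
    have hs : ∑ i ∈ s, σ i ((a : R) * r) = (a : R) * ∑ i ∈ s, σ i r := by
      rw [Finset.mul_sum]
      exact Finset.sum_congr rfl fun i hi ↦ by rw [map_mul, hσ i hi a a.2]
    rw [hs, ← mul_assoc, (hcomm a a.2).eq, mul_assoc]
  · ext
    change c * ∑ i ∈ s, σ i (r * (b : R)) = c * (∑ i ∈ s, σ i r) * (b : R)
    have hs : ∑ i ∈ s, σ i (r * (b : R)) = (∑ i ∈ s, σ i r) * (b : R) := by
      rw [Finset.sum_mul]
      exact Finset.sum_congr rfl fun i hi ↦ by rw [map_mul, hσ i hi b b.2]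
    rw [hs, mul_assoc]
  · ext
    change c * ∑ i ∈ s, σ i 1 = 1
    simp only [map_one, Finset.sum_const, nsmul_eq_mul, mul_one]
    exact hc1

end Retraction

/-! ### Fixed rings of finite groups -/

section FixedPoints

variable {Γ R : Type*} [Group Γ] [Ring R] [MulSemiringAction Γ R]

/-- Membership in the fixed subring: `r ∈ R^Γ ↔ ∀ γ, γ • r = r`. [folklore] -/
theorem mem_fixedPoints_subring_iff {r : R} : r ∈ FixedPoints.subring R Γ ↔ ∀ γ : Γ, γ • r = r :=
  Iff.rfl

/-- The inverse of the unit `n = |G|` (or of any invertible natural number) is fixed by every ring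
automorphism of the action: `γ • n⁻¹ = n⁻¹`, since `γ • n⁻¹` is again an inverse of `γ • n = n`.
[folklore] -/
theorem smul_unit_inv_natCast {n : ℕ} (u : Rˣ) (hu : (u : R) = n) (γ : Γ) :
    γ • ((u⁻¹ : Rˣ) : R) = (u⁻¹ : Rˣ) := by
  have hn : γ • ((n : ℕ) : R) = n := by
    rw [← MulSemiringAction.toRingHom_apply Γ R γ, map_natCast]
  have h1 : (γ • ((u⁻¹ : Rˣ) : R)) * (u : R) = 1 := by
    rw [hu, ← hn, ← smul_mul', ← hu, Units.inv_mul, smul_one]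
  calc γ • ((u⁻¹ : Rˣ) : R) = γ • ((u⁻¹ : Rˣ) : R) * ((u : R) * (u⁻¹ : Rˣ)) := by
        rw [Units.mul_inv, mul_one]
    _ = (u⁻¹ : Rˣ) := by rw [← mul_assoc, h1, one_mul]

/-- **The fixed ring of a finite group of automorphisms of a semisimple ring is semisimple, when the
order of the group is invertible** (Cohen–Montgomery 1975, Theorem, in the case `|G|⁻¹ ∈ R`;
Montgomery 1993, Lemma 4.3.2 for the trace `t(r) = |G|⁻¹ ∑_g g • r` being an `R^G`-bimodule map
onto `R^G`). [cite: CohenMontgomery1975, Theorem] -/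
theorem isSemisimpleRing_fixedPoints [Finite Γ] [IsSemisimpleRing R]
    (hunit : IsUnit ((Nat.card Γ : ℕ) : R)) : IsSemisimpleRing (FixedPoints.subring R Γ) := by
  classical
  letI := Fintype.ofFinite Γ
  obtain ⟨u, hu⟩ := hunit
  rw [Nat.card_eq_fintype_card] at hu
  refine isSemisimpleRing_subring_of_sum_mem (FixedPoints.subring R Γ) Finset.univ
    (fun γ ↦ MulSemiringAction.toRingHom Γ R γ) (fun γ _ a ha ↦ ha γ) (fun r γ ↦ ?_)
    ((u⁻¹ : Rˣ) : R) (fun γ ↦ smul_unit_inv_natCast u hu γ)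
    (fun a _ ↦ Commute.units_inv_left (hu ▸ Nat.cast_commute _ a)) ?_
  · -- `γ • ∑_g g • r = ∑_g (γ g) • r = ∑_g g • r`
    simp only [MulSemiringAction.toRingHom_apply, Finset.smul_sum, smul_smul]
    exact Function.Bijective.sum_comp (Group.mulLeft_bijective γ) (fun g ↦ g • r)
  · rw [Finset.card_univ, ← hu, Units.inv_mul]

/-- **Averaging over a finite image is invariant.** If a group `Γ` acts on a ring `R` through a
finite set `Φ` of ring endomorphisms, then `∑_{σ ∈ Φ} σ(r)` is fixed by `Γ`: left composition
with the automorphism `γ • ·` permutes `Φ` (with inverse `γ⁻¹ • ·`). [folklore] -/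
theorem smul_sum_range_toRingHom (hfin : (Set.range (MulSemiringAction.toRingHom Γ R)).Finite)
    (γ : Γ) (r : R) : γ • ∑ σ ∈ hfin.toFinset, σ r = ∑ σ ∈ hfin.toFinset, σ r := by
  classical
  have hmemΦ : ∀ {σ : R →+* R}, σ ∈ hfin.toFinset ↔ ∃ γ : Γ, MulSemiringAction.toRingHom Γ R γ = σ := by
    intro σ
    rw [Set.Finite.mem_toFinset, Set.mem_range]
  have hcomp : ∀ γ δ : Γ, (MulSemiringAction.toRingHom Γ R γ).comp (MulSemiringAction.toRingHom Γ R δ) =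
      MulSemiringAction.toRingHom Γ R (γ * δ) := fun γ δ ↦ by
    ext r
    simp [mul_smul]
  rw [Finset.smul_sum]
  refine Finset.sum_nbij' (fun σ ↦ (MulSemiringAction.toRingHom Γ R γ).comp σ)
    (fun σ ↦ (MulSemiringAction.toRingHom Γ R γ⁻¹).comp σ) (fun σ hσ ↦ ?_) (fun σ hσ ↦ ?_)
    (fun σ _ ↦ ?_) (fun σ _ ↦ ?_) (fun σ _ ↦ ?_)
  · obtain ⟨δ, rfl⟩ := hmemΦ.mp hσ
    exact hmemΦ.mpr ⟨γ * δ, (hcomp γ δ).symm⟩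
  · obtain ⟨δ, rfl⟩ := hmemΦ.mp hσ
    exact hmemΦ.mpr ⟨γ⁻¹ * δ, (hcomp γ⁻¹ δ).symm⟩
  · rw [← RingHom.comp_assoc, hcomp, inv_mul_cancel]
    ext r
    simp
  · rw [← RingHom.comp_assoc, hcomp, mul_inv_cancel]
    ext r
    simp
  · simp

/-- The finite image of the action is non-empty (it contains `1 • · = id`), so its cardinality is a
positive natural number. [folklore] -/
theorem card_toFinset_range_toRingHom_ne_zero
    (hfin : (Set.range (MulSemiringAction.toRingHom Γ R)).Finite) : hfin.toFinset.card ≠ 0 :=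
  Finset.card_ne_zero.mpr ⟨MulSemiringAction.toRingHom Γ R 1, hfin.mem_toFinset.mpr ⟨1, rfl⟩⟩

/-- An element of the finite image fixes the fixed subring pointwise. [folklore] -/
theorem apply_eq_self_of_mem_toFinset_range
    (hfin : (Set.range (MulSemiringAction.toRingHom Γ R)).Finite) {σ : R →+* R}
    (hσ : σ ∈ hfin.toFinset) {a : R} (ha : ∀ γ : Γ, γ • a = a) : σ a = a := by
  obtain ⟨γ, rfl⟩ := hfin.mem_toFinset.mp hσ
  exact ha γ

/-- **Fixed rings of groups acting through finitely many automorphisms.** Let a group `Γ` act on a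
semisimple ring `R` by ring automorphisms through a *finite* set `Φ` of ring endomorphisms (e.g. a
profinite group acting with open stabilisers on a finitely generated ring), with `|Φ|` invertible
in `R`. Then `R^Γ` is semisimple: `t(r) = |Φ|⁻¹ ∑_{σ ∈ Φ} σ(r)` is an `R^Γ`-bimodule retraction
(`γ ∘ Φ = Φ`, so `t(r)` is fixed, `smul_sum_range_toRingHom`). [cite: CohenMontgomery1975, Theorem] -/
theorem isSemisimpleRing_fixedPoints_of_finite_range [IsSemisimpleRing R]
    (hfin : (Set.range (MulSemiringAction.toRingHom Γ R)).Finite)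
    (hunit : IsUnit ((Nat.card (Set.range (MulSemiringAction.toRingHom Γ R)) : ℕ) : R)) :
    IsSemisimpleRing (FixedPoints.subring R Γ) := by
  obtain ⟨u, hu⟩ := hunit
  rw [Nat.card_coe_set_eq, Set.ncard_eq_toFinset_card _ hfin] at hu
  exact isSemisimpleRing_subring_of_sum_mem (FixedPoints.subring R Γ) hfin.toFinset (fun σ ↦ σ)
    (fun σ hσ a ha ↦ apply_eq_self_of_mem_toFinset_range hfin hσ ha)
    (fun r γ ↦ smul_sum_range_toRingHom hfin γ r) ((u⁻¹ : Rˣ) : R)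
    (fun γ ↦ smul_unit_inv_natCast u hu γ)
    (fun a _ ↦ Commute.units_inv_left (hu ▸ Nat.cast_commute _ a)) (by rw [← hu, Units.inv_mul])

/-- **Fixed rings of finite groups acting on semisimple `ℚ`-algebras are semisimple**: for a
`ℚ`-algebra the order of the group is automatically invertible
(`isSemisimpleRing_fixedPoints`). [cite: CohenMontgomery1975, Theorem] -/
theorem isSemisimpleRing_fixedPoints_of_algebraRat [Algebra ℚ R] [Finite Γ] [IsSemisimpleRing R] :
    IsSemisimpleRing (FixedPoints.subring R Γ) := by
  refine isSemisimpleRing_fixedPoints ?_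
  rw [← map_natCast (algebraMap ℚ R)]
  exact (IsUnit.mk0 _ (Nat.cast_ne_zero.mpr (Nat.card_pos (α := Γ)).ne')).map _

/-- **Fixed rings of groups acting through finitely many automorphisms of a semisimple
`ℚ`-algebra are semisimple** (`isSemisimpleRing_fixedPoints_of_finite_range`, the cardinality of
the finite image being invertible in a `ℚ`-algebra). [cite: CohenMontgomery1975, Theorem] -/
theorem isSemisimpleRing_fixedPoints_of_finite_range_of_algebraRat [Algebra ℚ R] [IsSemisimpleRing R]
    (hfin : (Set.range (MulSemiringAction.toRingHom Γ R)).Finite) :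
    IsSemisimpleRing (FixedPoints.subring R Γ) := by
  refine isSemisimpleRing_fixedPoints_of_finite_range hfin ?_
  rw [← map_natCast (algebraMap ℚ R)]
  haveI := hfin.to_subtype
  haveI : Nonempty (Set.range (MulSemiringAction.toRingHom Γ R)) := ⟨⟨_, 1, rfl⟩⟩
  exact (IsUnit.mk0 _ (Nat.cast_ne_zero.mpr Nat.card_pos.ne')).map _

end FixedPoints

/-! ### Retractions given integrally up to a non-zero integer -/

section RatTensor

variable {S₀ R₀ : Type*} [Ring S₀] [Ring R₀]

/-- **Semisimplicity of `ℚ ⊗ S₀` from that of `ℚ ⊗ R₀` along an integral trace.** Let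
`φ : S₀ → R₀` be a ring homomorphism and `τ : R₀ → S₀` an additive map with `τ (φ a · r) = a · τ r`,
`τ (r · φ b) = τ r · b` and `τ 1 = n` for a natural number `n ≠ 0` (an `S₀`-bimodule map with
`τ ∘ φ = n · id`, e.g. the trace of a group of order `n` descended to `S₀`). If `ℚ ⊗_ℤ R₀` is a
semisimple ring then so is `ℚ ⊗_ℤ S₀`: `t = n⁻¹ · (ℚ ⊗ τ)` is a bimodule retraction of
`ℚ ⊗ φ` (`isSemisimpleRing_of_retraction`). [folklore] -/
theorem isSemisimpleRing_ratTensor_of_trace (φ : S₀ →+* R₀) (τ : R₀ →+ S₀) (n : ℕ) (hn : n ≠ 0)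
    (hl : ∀ (a : S₀) (r : R₀), τ (φ a * r) = a * τ r)
    (hr : ∀ (r : R₀) (b : S₀), τ (r * φ b) = τ r * b) (h1 : τ 1 = n)
    [IsSemisimpleRing (ℚ ⊗[ℤ] R₀)] : IsSemisimpleRing (ℚ ⊗[ℤ] S₀) := by
  -- `f = ℚ ⊗ φ`, `t (q ⊗ r) = (n⁻¹ q) ⊗ τ r`
  let f : ℚ ⊗[ℤ] S₀ →+* ℚ ⊗[ℤ] R₀ :=
    (Algebra.TensorProduct.map (AlgHom.id ℤ ℚ) φ.toIntAlgHom).toRingHom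
  let t : ℚ ⊗[ℤ] R₀ →+ ℚ ⊗[ℤ] S₀ :=
    (TensorProduct.map (LinearMap.mulLeft ℤ ((n : ℚ)⁻¹)) τ.toIntLinearMap).toAddMonoidHom
  have hf : ∀ (q : ℚ) (a : S₀), f (q ⊗ₜ[ℤ] a) = q ⊗ₜ[ℤ] φ a := fun q a ↦
    Algebra.TensorProduct.map_tmul _ _ q a
  have ht : ∀ (q : ℚ) (r : R₀), t (q ⊗ₜ[ℤ] r) = ((n : ℚ)⁻¹ * q) ⊗ₜ[ℤ] τ r := fun q r ↦
    TensorProduct.map_tmul _ _ q r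
  refine isSemisimpleRing_of_retraction f t (fun x y ↦ ?_) (fun y x ↦ ?_) ?_
  · -- left linearity, checked on pure tensors
    induction x using TensorProduct.induction_on with
    | zero => rw [map_zero, zero_mul, zero_mul, map_zero]
    | add x₁ x₂ h₁ h₂ => rw [map_add, add_mul, map_add, h₁, h₂, add_mul]
    | tmul q a =>
      induction y using TensorProduct.induction_on with
      | zero => rw [mul_zero, map_zero, mul_zero]
      | add y₁ y₂ h₁ h₂ => rw [mul_add, map_add, h₁, h₂, map_add, mul_add]
      | tmul q' r =>
        rw [hf, Algebra.TensorProduct.tmul_mul_tmul, ht, ht, Algebra.TensorProduct.tmul_mul_tmul,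
          hl, mul_left_comm]
  · -- right linearity
    induction x using TensorProduct.induction_on with
    | zero => rw [map_zero, mul_zero, mul_zero, map_zero]
    | add x₁ x₂ h₁ h₂ => rw [map_add, mul_add, map_add, h₁, h₂, mul_add]
    | tmul q b =>
      induction y using TensorProduct.induction_on with
      | zero => rw [zero_mul, map_zero, zero_mul]
      | add y₁ y₂ h₁ h₂ => rw [add_mul, map_add, h₁, h₂, map_add, add_mul]
      | tmul q' r =>
        rw [hf, Algebra.TensorProduct.tmul_mul_tmul, ht, ht, Algebra.TensorProduct.tmul_mul_tmul,
          hr, mul_assoc]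
  · -- `t 1 = n⁻¹ ⊗ n = 1 ⊗ 1`
    change t ((1 : ℚ) ⊗ₜ[ℤ] (1 : R₀)) = (1 : ℚ) ⊗ₜ[ℤ] (1 : S₀)
    rw [ht, h1, mul_one, show (n : S₀) = (n : ℤ) • (1 : S₀) by rw [zsmul_one, Int.cast_natCast],
      ← TensorProduct.smul_tmul, zsmul_eq_mul, Int.cast_natCast,
      mul_inv_cancel₀ (Nat.cast_ne_zero.mpr hn)]

end RatTensor

end Literature.RingTheory.SimpleModule
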